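import Summits.BirchSwinnertonDyer.Rank1Residual.WAll.AltClosersX1ShaWitness
import Literature.NumberTheory.EllipticCurves.IsogenyIdProofs
import HarnessLib

/-!
# Rung W-ALL (D-0120) — row 4 (corner X1), rank `0`: ALT-CLOSERS BY NAME in DEEP Ш-WITNESS currency
# (no structural bet: every hypothesis is implied by W-ALL; cell `bsd-wall`, lane 2, seat ty-2 g5)

HONEST FRAMING (cell `bsd-wall`, run/shared/lean/pub/bsd-wall/; WALL-BRIEF-v1 §2; companion of
`WAll/AltClosersX1ShaWitness.lean`, p513686): THEOREMS ONLY — no definition, no named fact, no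
published theorem restated, nothing booked. CONDITIONAL closers: every hypothesis is named.

WHY A SECOND CURRENCY. `AltClosersX1ShaWitness` closes the rank-`0` X1 leaf from PUB⁵ + the
MIN-DIGIT cell `hmin` (a member `W'` of the Mazur class with `0 ≤ ord_p #Ш_an(W') ≤ 2`) + the
WITNESS-AT-DIGIT-TWO cell. Seat `bsd-wall-eis` g2 (HOME/STATUS 2026-08-27T09:02Z, THREAT OF RECORD):
by Matsuno, Manuscripta Math. 122 (2007) Cor. 5.4 + L. 3.5, both `p`-Selmer ranks grow in
`p`-isogenous families, so `hmin` — TRUE on the whole register (10 143 / 10 143 classes, `N < 5·10⁵`)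
— is presumably FALSE class-wide with unbounded conductor: a finite-register pricing device, not a
proof road for the infinite leaf. THIS FILE removes the bet: the certificate is read at ANY depth
through the tree lever `X1.bsdp_of_casselsTate_of_pow_dvd` —

  DEEP WITNESS at `(W', k)`: `ord_p #Ш(W')_an ≤ 2k` and `p^{2k-1} ∣ #Ш(W')`

(`k = 0`: the unit certificate; `k = 1`: one element of order `p`, the digit-`2` witness; `k = 2`: a
subgroup of order `p³`, what a SECOND `p`-isogeny descent delivers on the ten `(2,4)`-classes of
record — Creutz–Miller, J. Algebra 372 (2012)). Cassels–Tate squareness upgrades `p^{2k-1} ∣ #Ш` to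
`p^{2k} ∣ #Ш`, Kato–Wuthrich gives the other inequality, Cassels' invariance moves `BSD(W',p)` to
`BSD(W,p)`. And the cell is EXACT: `BSD(E,p)` at a rank-`0` pair hands back a deep witness on the curve
itself (`k = ⌈ord_p #Ш / 2⌉`; §0), so `hdeep` follows from `X1.RankZero.Statement` and from `WAll`
(§2) — nothing in this currency is stronger than the rung, at any conductor.

* §0 `exists_pow_dvd_shaOrder_of_bsdp` — `BSD(E,p)` + `Ш` finite ⇒ `∃ k, ord_p #Ш_an ≤ 2k ∧ p^{2k-1} ∣ #Ш`.
* §1 `x1RankZero_bsdp_of_deepWitness` (per pair), `x1RankZeroStatement_of_deepWitness` (A3 = both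
  rank-`0` slices), `wAllCornerX1RankZeroUnbalanced_of_deepWitnessU` (the unbalanced slice from the
  cell restricted to unbalanced leaf pairs) — inputs PUB⁵ (`hCT` Cassels–Tate bsd.S18, `hW` Wuthrich
  2014 Prop. 21, `hGZK`, `hmod`, `hCassels` Milne ADT I.7.3) + `hdeep`.
* §2 EXACTNESS `deepWitness_of_x1RankZeroStatement`, `deepWitness_of_wAll`; and SUBSUMPTION
  `deepWitness_of_minDigit_of_witness` (the shallow cells of `AltClosersX1ShaWitness` give `hdeep`
  with `k ∈ {0, 1}`).
* §3 registry: `wAllExclusions_of_sliceLeaves_x1DeepWitness`, `wAll_of_sliceLeaves_x1DeepWitness_primaryGZ`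
  (row 4 rank `0` by PUB + `hdeep`; SEVENTEEN named facts).

References: `Literature/…/Rank1Residual/X1RankZeroCertificate.lean` (`X1.bsdp_of_casselsTate_of_pow_dvd`),
`…/ClassX1Isogeny.lean`, `…/Wuthrich2014/ShaBoundProofs.lean` (`bsdp_of_isIsogenous`),
`WAll/AltClosersX1ShaWitness.lean`; [cite: Wuthrich2014, Prop. 21 (p. 400)] [cite: SilvermanAEC2009, Thm. X.4.14]
[cite: MilneADT2006, Thm. I.7.3] [cite: Miller2011LMS, Def. 1.1 (arXiv:1010.2431 p. 3)]
[cite: CreutzMiller2012, Thm. 1.1] [cite: Knapp1993, Thm. 11.67 (PDF p. 281)].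
-/

noncomputable section

open scoped Classical

open WeierstrassCurve Literature.NumberTheory.EllipticCurves
  Literature.NumberTheory.EllipticCurves.Rank1Residual
  Literature.NumberTheory.EllipticCurves.Rank1Residual.Typed
  Literature.NumberTheory.EllipticCurves.Wuthrich2014
  Literature.NumberTheory.EllipticCurves.ModularForms

set_option autoImplicit false

namespace Summit.BirchSwinnertonDyer.Rank1Residual.WAll

open Summit.BirchSwinnertonDyer
open Summit.BirchSwinnertonDyer.BirchSwinnertonDyer.Rank1Residual (NonCMAtTwo BSDpOnClassX9)

/-! ## §0 Exactness kernel: `BSD(E,p)` hands back a deep witness on the curve itself -/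

/-- **`BSD(E,p)` + `Ш` finite ⇒ a deep witness**: with `v = ord_p #Ш(W)` one has `ord_p #Ш_an = v`
(Miller's clause (iv) and `#Ш(p) = p^v`), and `k = ⌈v/2⌉` gives `v ≤ 2k`, `2k − 1 ≤ v`, so
`p^{2k-1} ∣ p^v ∣ #Ш`. No squareness is used. [cite: Miller2011LMS, Def. 1.1 (arXiv:1010.2431 p. 3)] -/
theorem exists_pow_dvd_shaOrder_of_bsdp (W : WeierstrassCurve ℚ) [W.IsElliptic] (p : ℕ) [Fact p.Prime]
    (hfin : Finite W.sha) (h : BSDp W p) {q : ℚ} (hq : shaAn W = (q : ℂ)) :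
    ∃ k : ℕ, padicValRat p q ≤ 2 * k ∧ p ^ (2 * k - 1) ∣ W.shaOrder := by
  obtain ⟨-, -, q₀, hq₀, hval⟩ := h
  have hqq : q₀ = q := by exact_mod_cast hq₀.symm.trans hq
  subst hqq
  haveI := hfin
  set v : ℕ := (Nat.card W.sha).factorization p with hv
  have hcard : Nat.card (AddCommGroup.primaryComponent W.sha p) = p ^ v :=
    card_addPrimaryComponent_eq_pow p
  have hval' : padicValRat p q₀ = v := by
    rw [hval, hcard, padicValNat.prime_pow]
  refine ⟨(v + 1) / 2, ?_, ?_⟩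
  · rw [hval']
    exact_mod_cast (by omega : v ≤ 2 * ((v + 1) / 2))
  · rw [WeierstrassCurve.shaOrder]
    exact (pow_dvd_pow p (by omega : 2 * ((v + 1) / 2) - 1 ≤ v)).trans (Nat.ordProj_dvd _ _)

/-! ## §1 The rank-`0` X1 leaf from PUB⁵ + the DEEP-WITNESS cell -/

/-- **`BSD(E,p)` at every rank-`0` X1 pair from the deep-witness cell**: at the located member `W'`
(class X1 and rank `0` transported along the isogeny) the lever `X1.bsdp_of_casselsTate_of_pow_dvd`
(Kato–Wuthrich + Cassels–Tate squareness + the certificate `p^{2k-1} ∣ #Ш(W')`) gives `BSD(W',p)`,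
and Cassels' invariance (`bsdp_of_isIsogenous`; `Ш(W')` finite and `L(W',1) ≠ 0` by GZK / modularity)
carries it to `W`. CONDITIONAL; nothing closed. [cite: Wuthrich2014, Prop. 21 (p. 400)]
[cite: SilvermanAEC2009, Thm. X.4.14] [cite: MilneADT2006, Thm. I.7.3] [cite: Knapp1993, Thm. 11.67 (PDF p. 281)] -/
theorem x1RankZero_bsdp_of_deepWitness (hCT : exists_casselsTate_pairing (K := ℚ))
    (hW : sha_dvd_analyticSha) (hGZK : rank_eq_analyticRank_of_analyticRank_le_one)
    (hmod : hasEntireLFunction_rat) (hCassels : bsdRHS_eq_of_isIsogenous)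
    (hdeep : ∀ (W : WeierstrassCurve ℚ) [W.IsElliptic] [W.IsGloballyMinimal] (p : ℕ)
      [Fact p.Prime], ClassX1 W p → W.analyticRank = 0 →
      ∃ (W' : WeierstrassCurve ℚ) (_ : W'.IsElliptic) (_ : W'.IsGloballyMinimal), IsIsogenous W W' ∧
        ∃ q : ℚ, shaAn W' = (q : ℂ) ∧ ∃ k : ℕ, padicValRat p q ≤ 2 * k ∧ p ^ (2 * k - 1) ∣ W'.shaOrder)
    (W : WeierstrassCurve ℚ) [W.IsElliptic] [W.IsGloballyMinimal] (p : ℕ) [Fact p.Prime]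
    (hX : ClassX1 W p) (hr0 : W.analyticRank = 0) : BSDp W p := by
  obtain ⟨W', iE, iM, hiso, q, hq, k, hv, hdvd⟩ := hdeep W p hX hr0
  have hX' : ClassX1 W' p := ClassX1.of_isIsogenous hiso hX
  have hr0' : W'.analyticRank = 0 := (analyticRank_eq_of_isIsogenous' hiso) ▸ hr0
  have h' : BSDp W' p :=
    X1.bsdp_of_casselsTate_of_pow_dvd hCT hW hGZK hmod W' p (by omega) hX' hr0' hq hv hdvd
  obtain ⟨-, hfin'⟩ := hGZK W' (by omega)
  have hL' : W'.entireLFunction 1 ≠ 0 := (W'.analyticRank_eq_zero_iff_holds (hmod W')).mp hr0'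
  have hlead : W'.leadingLCoeff ≠ 0 := by
    rwa [W'.leadingLCoeff_eq_of_analyticRank_eq_zero hr0']
  exact bsdp_of_isIsogenous hCassels hiso hfin' hlead h'

/-- **The rank-`0` X1 leaf statement (ladder row A3 = both rank-`0` slices of row 4) ⇐ PUB⁵ +
`hdeep`.** CONDITIONAL; nothing closed. [cite: Wuthrich2014, Prop. 21 (p. 400)]
[cite: SilvermanAEC2009, Thm. X.4.14] [cite: MilneADT2006, Thm. I.7.3] -/
theorem x1RankZeroStatement_of_deepWitness (hCT : exists_casselsTate_pairing (K := ℚ))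
    (hW : sha_dvd_analyticSha) (hGZK : rank_eq_analyticRank_of_analyticRank_le_one)
    (hmod : hasEntireLFunction_rat) (hCassels : bsdRHS_eq_of_isIsogenous)
    (hdeep : ∀ (W : WeierstrassCurve ℚ) [W.IsElliptic] [W.IsGloballyMinimal] (p : ℕ)
      [Fact p.Prime], ClassX1 W p → W.analyticRank = 0 →
      ∃ (W' : WeierstrassCurve ℚ) (_ : W'.IsElliptic) (_ : W'.IsGloballyMinimal), IsIsogenous W W' ∧
        ∃ q : ℚ, shaAn W' = (q : ℂ) ∧ ∃ k : ℕ, padicValRat p q ≤ 2 * k ∧ p ^ (2 * k - 1) ∣ W'.shaOrder) :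
    X1.RankZero.Statement :=
  fun W _ _ p _ hL ↦ x1RankZero_bsdp_of_deepWitness hCT hW hGZK hmod hCassels hdeep W p hL.1 hL.2

/-- **The UNBALANCED rank-`0` slice `WAllCornerX1RankZeroUnbalanced` ⇐ PUB⁵ + the deep-witness
cell RESTRICTED to unbalanced leaf pairs** (balance predicate verbatim the slice's). CONDITIONAL;
nothing closed. [cite: Wuthrich2014, Prop. 21 (p. 400)] [cite: SilvermanAEC2009, Thm. X.4.14]
[cite: MilneADT2006, Thm. I.7.3] -/
theorem wAllCornerX1RankZeroUnbalanced_of_deepWitnessU (hCT : exists_casselsTate_pairing (K := ℚ))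
    (hW : sha_dvd_analyticSha) (hGZK : rank_eq_analyticRank_of_analyticRank_le_one)
    (hmod : hasEntireLFunction_rat) (hCassels : bsdRHS_eq_of_isIsogenous)
    (hdeepU : ∀ (W : WeierstrassCurve ℚ) [W.IsElliptic] [W.IsGloballyMinimal] (p : ℕ)
      [Fact p.Prime], X1.RankZero.Leaf W p →
      ¬ (Squarefree (W.conductorNorm ℤ) ∧
        ∃ (W' : WeierstrassCurve ℚ) (_ : W'.IsElliptic) (_ : W'.IsGloballyMinimal),
          IsIsogenous W W' ∧ p ∣ W'.torsionOrder ∧ padicValNat p W'.tamagawaProduct = 1) →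
      ∃ (W' : WeierstrassCurve ℚ) (_ : W'.IsElliptic) (_ : W'.IsGloballyMinimal), IsIsogenous W W' ∧
        ∃ q : ℚ, shaAn W' = (q : ℂ) ∧ ∃ k : ℕ, padicValRat p q ≤ 2 * k ∧ p ^ (2 * k - 1) ∣ W'.shaOrder) :
    WAllCornerX1RankZeroUnbalanced := by
  intro W _ _ p _ hL hU
  obtain ⟨W', iE, iM, hiso, q, hq, k, hv, hdvd⟩ := hdeepU W p hL hU
  have hX' : ClassX1 W' p := ClassX1.of_isIsogenous hiso hL.1
  have hr0' : W'.analyticRank = 0 := (analyticRank_eq_of_isIsogenous' hiso) ▸ hL.2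
  have h' : BSDp W' p :=
    X1.bsdp_of_casselsTate_of_pow_dvd hCT hW hGZK hmod W' p (by omega) hX' hr0' hq hv hdvd
  obtain ⟨-, hfin'⟩ := hGZK W' (by omega)
  have hL' : W'.entireLFunction 1 ≠ 0 := (W'.analyticRank_eq_zero_iff_holds (hmod W')).mp hr0'
  have hlead : W'.leadingLCoeff ≠ 0 := by
    rwa [W'.leadingLCoeff_eq_of_analyticRank_eq_zero hr0']
  exact bsdp_of_isIsogenous hCassels hiso hfin' hlead h'

/-! ## §2 Exactness (the cell follows from the leaf and from W-ALL) and subsumption -/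

/-- **The DEEP-WITNESS cell follows from the rank-`0` leaf statement** — witness on the curve itself
(`isIsogenous_self`), `q = #Ш_an`, `k = ⌈ord_p #Ш / 2⌉` (§0; `Ш` finite by GZK). So the cell is
residue-exact at every conductor: no structural bet remains. [cite: Miller2011LMS, Def. 1.1 (arXiv:1010.2431 p. 3)] -/
theorem deepWitness_of_x1RankZeroStatement (hGZK : rank_eq_analyticRank_of_analyticRank_le_one)
    (hS : X1.RankZero.Statement) :
    ∀ (W : WeierstrassCurve ℚ) [W.IsElliptic] [W.IsGloballyMinimal] (p : ℕ)
      [Fact p.Prime], ClassX1 W p → W.analyticRank = 0 →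
      ∃ (W' : WeierstrassCurve ℚ) (_ : W'.IsElliptic) (_ : W'.IsGloballyMinimal), IsIsogenous W W' ∧
        ∃ q : ℚ, shaAn W' = (q : ℂ) ∧ ∃ k : ℕ, padicValRat p q ≤ 2 * k ∧ p ^ (2 * k - 1) ∣ W'.shaOrder := by
  intro W iE iM p _ hX hr0
  have h : BSDp W p := hS W p ⟨hX, hr0⟩
  obtain ⟨-, hfin⟩ := hGZK W (by omega)
  have h' := h
  obtain ⟨-, -, q, hq, -⟩ := h'
  exact ⟨W, iE, iM, isIsogenous_self W, q, hq, exists_pow_dvd_shaOrder_of_bsdp W p hfin h hq⟩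

/-- **… and from `WAll`.** [cite: Miller2011LMS, Def. 1.1 (arXiv:1010.2431 p. 3)] -/
theorem deepWitness_of_wAll (hGZK : rank_eq_analyticRank_of_analyticRank_le_one) (h : WAll) :
    ∀ (W : WeierstrassCurve ℚ) [W.IsElliptic] [W.IsGloballyMinimal] (p : ℕ)
      [Fact p.Prime], ClassX1 W p → W.analyticRank = 0 →
      ∃ (W' : WeierstrassCurve ℚ) (_ : W'.IsElliptic) (_ : W'.IsGloballyMinimal), IsIsogenous W W' ∧
        ∃ q : ℚ, shaAn W' = (q : ℂ) ∧ ∃ k : ℕ, padicValRat p q ≤ 2 * k ∧ p ^ (2 * k - 1) ∣ W'.shaOrder :=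
  deepWitness_of_x1RankZeroStatement hGZK fun W _ _ p _ hL ↦ h W p (by have h0 := hL.2; omega)

/-- **Subsumption: the shallow cells of `AltClosersX1ShaWitness` give the deep cell** with
`k ∈ {0, 1}` (digit `0`: `k = 0`, `p⁰ ∣ #Ш`; digit `1`–`2`: `k = 1`, `p ∣ #Ш(W')` from the witness by
`Typed.dvd_shaOrder_of_exists_torsion`). [folklore] -/
theorem deepWitness_of_minDigit_of_witness
    (hmin : ∀ (W : WeierstrassCurve ℚ) [W.IsElliptic] [W.IsGloballyMinimal] (p : ℕ)
      [Fact p.Prime], ClassX1 W p → W.analyticRank = 0 →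
      ∃ (W' : WeierstrassCurve ℚ) (_ : W'.IsElliptic) (_ : W'.IsGloballyMinimal), IsIsogenous W W' ∧
        ∃ q : ℚ, shaAn W' = (q : ℂ) ∧ 0 ≤ padicValRat p q ∧ padicValRat p q ≤ 2)
    (hwit : ∀ (W W' : WeierstrassCurve ℚ) [W.IsElliptic] [W.IsGloballyMinimal]
      [W'.IsElliptic] [W'.IsGloballyMinimal] (p : ℕ) [Fact p.Prime], ClassX1 W p → W.analyticRank = 0 →
      IsIsogenous W W' → ∀ q : ℚ, shaAn W' = (q : ℂ) → 0 < padicValRat p q → padicValRat p q ≤ 2 →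
      ∃ x : W'.sha, x ≠ 0 ∧ p • x = 0) :
    ∀ (W : WeierstrassCurve ℚ) [W.IsElliptic] [W.IsGloballyMinimal] (p : ℕ)
      [Fact p.Prime], ClassX1 W p → W.analyticRank = 0 →
      ∃ (W' : WeierstrassCurve ℚ) (_ : W'.IsElliptic) (_ : W'.IsGloballyMinimal), IsIsogenous W W' ∧
        ∃ q : ℚ, shaAn W' = (q : ℂ) ∧ ∃ k : ℕ, padicValRat p q ≤ 2 * k ∧ p ^ (2 * k - 1) ∣ W'.shaOrder := by
  intro W _ _ p _ hX hr0
  obtain ⟨W', iE, iM, hiso, q, hq, hv0, hv⟩ := hmin W p hX hr0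
  rcases hv0.eq_or_lt with h0 | hpos
  · exact ⟨W', iE, iM, hiso, q, hq, 0, by rw [← h0]; norm_num, by simp⟩
  · exact ⟨W', iE, iM, hiso, q, hq, 1, by simpa using hv,
      by simpa using dvd_shaOrder_of_exists_torsion W' p (hwit W W' p hX hr0 hiso q hq hpos hv)⟩

/-! ## §3 The registry with row 4 rank `0` in deep-witness currency -/

/-- **THE CLOSED LIST with row 4 rank `0` by PUB + the deep-witness cell** (as
`wAllExclusions_of_sliceLeaves_x1Slices`, the two rank-`0` X1 slices fed by §1). [folklore] -/
theorem wAllExclusions_of_sliceLeaves_x1DeepWitness (h5 : NonCMAtTwo)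
    (h30 : WAllExclAdditiveAtThreeRankZero) (h31 : WAllExclAdditiveAtThreeRankOne)
    (h50 : WAllExclAdditiveFiveLeRankZero) (h51 : WAllExclAdditiveFiveLeRankOne)
    (hK2a : X11b.MultiplicativeRankOne) (hK2b : X11b.MultiplicativeRankOneAtThree)
    (hCT : exists_casselsTate_pairing (K := ℚ)) (hCassels : bsdRHS_eq_of_isIsogenous)
    (hdeep : ∀ (W : WeierstrassCurve ℚ) [W.IsElliptic] [W.IsGloballyMinimal] (p : ℕ)
      [Fact p.Prime], ClassX1 W p → W.analyticRank = 0 →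
      ∃ (W' : WeierstrassCurve ℚ) (_ : W'.IsElliptic) (_ : W'.IsGloballyMinimal), IsIsogenous W W' ∧
        ∃ q : ℚ, shaAn W' = (q : ℂ) ∧ ∃ k : ℕ, padicValRat p q ≤ 2 * k ∧ p ^ (2 * k - 1) ∣ W'.shaOrder)
    (hX1R1 : X1.RankOne.Statement) (hX2 : X2.Target)
    (hK3 : Supersingular.SignedSupersingular)
    (h73 : WAllCornerX7AtThree) (h75 : WAllCornerX7FiveLe)
    (hK6 : BSDpOnClassX9) (hX10b : X10.BSDpOnClassX10b) (hX11a : X11a.Target)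
    (hF3 : WAllCornerFInertBadAtThree) (hF5 : WAllCornerFInertBadFiveLe)
    (hF2 : WAllCornerFTwo) (hFr : WAllCornerFRamified)
    (hW : sha_dvd_analyticSha) (hmod : hasEntireLFunction_rat)
    (hGZK : rank_eq_analyticRank_of_analyticRank_le_one) : WAllExclusions := by
  obtain ⟨hB, hU⟩ := x1RankZeroStatement_iff_balanced_unbalanced.mp
    (x1RankZeroStatement_of_deepWitness hCT hW hGZK hmod hCassels hdeep)
  exact wAllExclusions_of_sliceLeaves_x1Slices h5 h30 h31 h50 h51 hK2a hK2b hB hU hX1R1 hX2 hK3 h73 h75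
    hK6 hX10b hX11a hF3 hF5 hF2 hFr hW hmod hGZK

/-- **W-ALL with row 4 rank `0` in deep-witness currency, SEVENTEEN named facts, the Gross–Zagier
side primary** (`hmod`, `hGZK` derived). Every hypothesis is a registered leaf, a typed target, a
published fact, or (`hdeep`) a cell implied by W-ALL itself (`deepWitness_of_wAll`).
[cite: Darmon2004, Thm. 3.22 and §3.9] [cite: Wuthrich2014, Prop. 21 (p. 400)] -/
theorem wAll_of_sliceLeaves_x1DeepWitness_primaryGZ (h5 : NonCMAtTwo)
    (h30 : WAllExclAdditiveAtThreeRankZero) (h31 : WAllExclAdditiveAtThreeRankOne)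
    (h50 : WAllExclAdditiveFiveLeRankZero) (h51 : WAllExclAdditiveFiveLeRankOne)
    (hK2a : X11b.MultiplicativeRankOne) (hK2b : X11b.MultiplicativeRankOneAtThree)
    (hCT : exists_casselsTate_pairing (K := ℚ)) (hCassels : bsdRHS_eq_of_isIsogenous)
    (hdeep : ∀ (W : WeierstrassCurve ℚ) [W.IsElliptic] [W.IsGloballyMinimal] (p : ℕ)
      [Fact p.Prime], ClassX1 W p → W.analyticRank = 0 →
      ∃ (W' : WeierstrassCurve ℚ) (_ : W'.IsElliptic) (_ : W'.IsGloballyMinimal), IsIsogenous W W' ∧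
        ∃ q : ℚ, shaAn W' = (q : ℂ) ∧ ∃ k : ℕ, padicValRat p q ≤ 2 * k ∧ p ^ (2 * k - 1) ∣ W'.shaOrder)
    (hX1R1 : X1.RankOne.Statement) (hX2 : X2.Target)
    (hK3 : Supersingular.SignedSupersingular)
    (h73 : WAllCornerX7AtThree) (h75 : WAllCornerX7FiveLe)
    (hK6 : BSDpOnClassX9) (hX10b : X10.BSDpOnClassX10b) (hX11a : X11a.Target)
    (hF3 : WAllCornerFInertBadAtThree) (hF5 : WAllCornerFInertBadFiveLe)
    (hF2 : WAllCornerFTwo) (hFr : WAllCornerFRamified)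
    (hW : sha_dvd_analyticSha)
    (hSk : Skinner2016.thmC_padicValRat_bsd_rank_zero)
    (hBCS : BurungaleCastellaSkinner2025.cor131_padicValRat_bsd_rank_le_one)
    (hJSW : JetchevSkinnerWan2017.thm121_padicValRat_bsd_rank_one)
    (hCGS : CastellaGrossiSkinner2025.thmD_padicValRat_bsd_rank_le_one)
    (hGV : GreenbergVatsal2000.thm13_charIdeal_eq_of_gvPar) (hGr : greenberg_charValue_rankZero)
    (hmodP : nonempty_modularParametrizationData)
    (hWa : waldspurger_exists_heegnerField_twist_ne_zero)
    (hMM : murtyMurty_exists_heegnerField_twist_simpleZero)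
    (hGZ : ∀ (N : ℕ) [NeZero N] (W : WeierstrassCurve ℚ) (K : Type) [Field K] [NumberField K],
      gross_zagier N W K)
    (hKo : ∀ (N : ℕ) [NeZero N] (W : WeierstrassCurve ℚ) (K : Type) [Field K] [NumberField K],
      kolyvagin N W K)
    (hCM : bsdTriple_of_hasCM_of_L_one_ne_zero) (hKob : Kobayashi2013.cor14_bsdp_of_cm_rank_one)
    (hYZ : YanZhu2026.thm415_padicValRat_bsd_rank_le_one)
    (hLLT : LiLiuTian2024.thm11_bsdp_of_cm_rank_one) : WAll :=
  have hmod : hasEntireLFunction_rat :=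
    X2.ClassClosureEntireFree.hasEntireLFunction_rat_of_nonempty_modularParametrizationData hmodP
  have hGZK : rank_eq_analyticRank_of_analyticRank_le_one :=
    rank_eq_analyticRank_of_analyticRank_le_one_of_nonempty_modularParametrizationData hmodP hWa hMM
      hGZ hKo
  wAll_of_exclusions_primaryGZ
    (wAllExclusions_of_sliceLeaves_x1DeepWitness h5 h30 h31 h50 h51 hK2a hK2b hCT hCassels hdeep hX1R1
      hX2 hK3 h73 h75 hK6 hX10b hX11a hF3 hF5 hF2 hFr hW hmod hGZK)
    hSk hBCS hJSW hCGS hGV hGr hmodP hWa hMM hGZ hKo hCM hKob hYZ hLLT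

end Summit.BirchSwinnertonDyer.Rank1Residual.WAll

end
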